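import Summits.RiemannHypothesis.RiemannHypothesis.Theorems.TiltedLandingLaw421R3IsoTilt2

/-! # TiltedLandingLaw421R3IsoTilt3 — W-08: LANDING FROM THE CIRCLE TEST ALONE (convexity clause removed) and the ALOFT lemma (C4 «kernel desk» rh-idea-6 g29, §F.10)
PART 5 of the far-step kit, against the TREE modules `…R3IsoTilt1` (#1036: `existsUnique_crit_of_isolated`, `crit_im_eq_zero_of_real`, `tilt_of_isolated`,
`readyR2_of_isolated`) and `…R3IsoTilt2` (#1037: pair factorisation, `readyR2_of_tracked_pair`). Answers betaR g3's STUCK-LEMMA question on `FarEnergyLawQ`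
(«does FarLevel + Charged give `v.im ≥ s/η`?»).
THE POINT. The tree's landing lemma `tilt_of_isolated` / `readyR2_of_tracked_pair` needs TWO smallness tests: the CIRCLE test `‖q·(h′/h)‖ < 2r` on `‖z − a‖ = r`
(Rouché ⇒ exactly one critical point in the disc, and it is real) and a DIAMETER CONVEXITY test (`hsmall2`/`hconv`, a `|h″|`-type bound) used only for the NL sign
`0 ≤ G·G″`. The convexity test is SUPERFLUOUS: write `G′ = h·Ψ` with `Ψ := 2(z − a) + q·(h′/h)`; on the diameter `Ψ` is real, `Ψ(a − r) < 0 < Ψ(a + r)` by the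
circle test at the two real points of the circle, and `Ψ` has exactly ONE zero `c` in the disc (uniqueness of the critical point); so `Ψ < 0` on `[a − r, c)`,
`Ψ > 0` on `(c, a + r]` (IVT), hence `Ψ′(c) ≥ 0` (slope limit), and `G(c)·G″(c) = q(c)·h(c)²·Ψ′(c) ≥ 0` since `G″(c) = h(c)Ψ′(c)`. RESULTS: ★ `deriv_nonneg_of_unique_zero`
(the real-variable core), ★★★ `tilt_of_isolated_circle` (= `tilt_of_isolated` minus `hsmall2`), `readyR2_of_isolated_circle`, ★★★ `readyR2_of_tracked_pair_circle`
(= `readyR2_of_tracked_pair` minus `hconv`), `two_mul_sub_div_pairQ` (`2(z − a)/q(z) = 1/(z − v) + 1/(z − v̄)`, the dictionary to the hands' `Σ m_u/(z − u)`),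
★★★ `aloft_of_not_readyR2`: a tracked SIMPLE isolated pair `a + ib` of `f⁽ʲ⁾` in `ball a ρ` (`b < ρ`), cofactor field `‖G′/G − 2(z − a)/q‖ ≤ L` on the punctured ball,
range `|a − x₀| + ρ ≤ (j+3)R/2`, and level `j` NOT Ready′ ⇒ `1 ≤ b·L` — with `L = η/s`: `s/η ≤ lowH_j` = the ALOFT hypothesis of part 4's `nested_step_energy_eta`.
SUPPORT for crux `TiltedLandingLaw421` (stmt-RiemannHypothesis-24774), `--supports … --as helper` only; sorry-free. Nothing here bears on the truth of RH;
RH is NOT proved; 24774 OPEN. -/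

namespace RhW08.IsolatedTilt

open Complex Metric Set Filter Topology
open scoped ComplexConjugate

/-! ## §F.10a the real-variable core: a unique transversal zero has non-negative slope -/

/-- ★ (K) §F.10a **UNIQUE ZERO ⇒ NON-NEGATIVE DERIVATIVE**: `ψ` continuous on `[a − r, a + r]`, `ψ(a − r) < 0 < ψ(a + r)`, `c` (`|c − a| < r`) a zero of `ψ` and
its ONLY zero in the open interval, `ψ` differentiable at `c` with derivative `d` ⇒ `0 ≤ d` (IVT: `ψ < 0` left of `c`, `ψ > 0` right of `c`; slope limit). -/
theorem deriv_nonneg_of_unique_zero {ψ : ℝ → ℝ} {a r c d : ℝ}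
    (hcont : ContinuousOn ψ (Icc (a - r) (a + r)))
    (hleft : ψ (a - r) < 0) (hright : 0 < ψ (a + r)) (hca : |c - a| < r) (hψc : ψ c = 0)
    (hzero : ∀ x : ℝ, |x - a| < r → ψ x = 0 → x = c) (hd : HasDerivAt ψ d c) : 0 ≤ d := by
  obtain ⟨hc1, hc2⟩ := abs_lt.mp hca
  have hneg : ∀ x : ℝ, a - r < x → x < c → ψ x < 0 := by
    intro x hx1 hx2
    have hxa : |x - a| < r := abs_lt.mpr ⟨by linarith, by linarith⟩
    by_contra hcon
    push Not at hcon
    rcases hcon.eq_or_lt with h0 | hpos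
    · have := hzero x hxa h0.symm
      linarith
    · have hsub : Icc (a - r) x ⊆ Icc (a - r) (a + r) := Icc_subset_Icc le_rfl (by linarith)
      have h01 : (0 : ℝ) ∈ Icc (ψ (a - r)) (ψ x) := ⟨hleft.le, hpos.le⟩
      obtain ⟨y, hy, hy0⟩ := intermediate_value_Icc (by linarith) (hcont.mono hsub) h01
      have hy1 : a - r < y := by
        rcases hy.1.eq_or_lt with h | h
        · rw [← h] at hy0; linarith
        · exact h
      have hya : |y - a| < r := abs_lt.mpr ⟨by linarith, by linarith [hy.2]⟩
      have := hzero y hya hy0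
      linarith [hy.2]
  have hpos : ∀ x : ℝ, c < x → x < a + r → 0 < ψ x := by
    intro x hx1 hx2
    have hxa : |x - a| < r := abs_lt.mpr ⟨by linarith, by linarith⟩
    by_contra hcon
    push Not at hcon
    rcases hcon.lt_or_eq with hlt | h0
    · have hsub : Icc x (a + r) ⊆ Icc (a - r) (a + r) := Icc_subset_Icc (by linarith) le_rfl
      have h01 : (0 : ℝ) ∈ Icc (ψ x) (ψ (a + r)) := ⟨hlt.le, hright.le⟩
      obtain ⟨y, hy, hy0⟩ := intermediate_value_Icc (by linarith) (hcont.mono hsub) h01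
      have hy2 : y < a + r := by
        rcases hy.2.lt_or_eq with h | h
        · exact h
        · rw [h] at hy0; linarith
      have hya : |y - a| < r := abs_lt.mpr ⟨by linarith [hy.1], by linarith⟩
      have := hzero y hya hy0
      linarith [hy.1]
    · have := hzero x hxa h0
      linarith
  have ht : Tendsto (slope ψ c) (𝓝[≠] c) (𝓝 d) := hasDerivAt_iff_tendsto_slope.mp hd
  have hev : ∀ᶠ x in 𝓝[≠] c, 0 ≤ slope ψ c x := by
    have h1 : Ioo (a - r) (a + r) ∈ 𝓝[≠] c := mem_nhdsWithin_of_mem_nhds (Ioo_mem_nhds (by linarith) (by linarith))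
    have h2 : ({c}ᶜ : Set ℝ) ∈ 𝓝[≠] c := self_mem_nhdsWithin
    filter_upwards [h1, h2] with x hx hxc
    have hxc' : x ≠ c := hxc
    rw [slope_def_field, hψc, sub_zero]
    rcases lt_or_gt_of_ne hxc' with hlt | hgt
    · exact (div_pos_of_neg_of_neg (hneg x hx.1 hlt) (by linarith)).le
    · exact (div_pos (hpos x hgt hx.2) (by linarith)).le
  exact ge_of_tendsto ht hev

/-! ## §F.10b LANDING FROM THE CIRCLE TEST ALONE -/

/-- ★★★ (K) §F.10b **ISOLATED PAIR ⇒ TILT, CIRCLE TEST ONLY** (= `tilt_of_isolated` WITHOUT the convexity clause `hsmall2`): `G = q·h` on `ball a ρ`, `h` holomorphic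
and zero-free there, `‖q·(h′/h)‖ < 2r` on the circle `‖z − a‖ = r` (`0 < r < ρ`), `G` real, `h, h′, h″` real on the diameter ⇒ a REAL point `x`, `|x − a| < r`, with
`G′ x = 0`, `Re G x ≠ 0`, `0 ≤ Re G x · Re G″ x`. -/
theorem tilt_of_isolated_circle {G h : ℂ → ℂ} {a b r ρ : ℝ} (hr : 0 < r) (hrρ : r < ρ) (hb : 0 < b)
    (hh : DifferentiableOn ℂ h (ball (a : ℂ) ρ)) (hh0 : ∀ z ∈ ball (a : ℂ) ρ, h z ≠ 0)
    (hG : ∀ z ∈ ball (a : ℂ) ρ, G z = pairQ a b z * h z)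
    (hsmall : ∀ z : ℂ, ‖z - a‖ = r → ‖pairQ a b z * (deriv h z / h z)‖ < 2 * r)
    (hGreal : ∀ z : ℂ, G (conj z) = conj (G z))
    (hreal : ∀ x : ℝ, |x - a| < r → (h x).im = 0 ∧ (deriv h x).im = 0 ∧ (deriv (deriv h) x).im = 0) :
    ∃ x : ℝ, |x - a| < r ∧ deriv G x = 0 ∧ (G x).re ≠ 0 ∧ 0 ≤ (G x).re * (deriv (deriv G) x).re := by
  obtain ⟨u, hu, hGu, huniq⟩ := existsUnique_crit_of_isolated hr hrρ hh hh0 hG hsmall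
  have hxball : ∀ x : ℝ, |x - a| ≤ r → ((x : ℂ) ∈ ball (a : ℂ) ρ) := by
    intro x hx
    rw [mem_ball, dist_eq_norm, ← Complex.ofReal_sub, Complex.norm_real, Real.norm_eq_abs]
    exact lt_of_le_of_lt hx hrρ
  have huball : u ∈ ball (a : ℂ) ρ := by rw [mem_ball, dist_eq_norm]; exact hu.trans hrρ
  have him : u.im = 0 := crit_im_eq_zero_of_real hGreal (differentiableAt_of_pair_mul hh hG huball) hu hGu huniq
  set c : ℝ := u.re with hc_def
  have huc : u = (c : ℂ) := Complex.ext (by simp [hc_def]) (by simp [him])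
  have hca : |c - a| < r := by
    have : ‖(c : ℂ) - (a : ℂ)‖ < r := by rw [← huc]; exact hu
    rwa [← Complex.ofReal_sub, Complex.norm_real, Real.norm_eq_abs] at this
  have hcball := hxball c hca.le
  -- the critical factor `Ψ`: `G′ = h·Ψ` on the ball
  set Ψ : ℂ → ℂ := fun z => 2 * (z - a) + pairQ a b z * (deriv h z / h z) with hΨ_def
  have hGΨ : ∀ z ∈ ball (a : ℂ) ρ, deriv G z = h z * Ψ z := by
    intro z hz
    rw [deriv_pair_mul hh hG hz]
    have hz0 := hh0 z hz
    simp only [hΨ_def]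
    field_simp
  have hΨd : DifferentiableOn ℂ Ψ (ball (a : ℂ) ρ) := by
    have hd : DifferentiableOn ℂ (deriv h) (ball (a : ℂ) ρ) := hh.deriv isOpen_ball
    have hq : DifferentiableOn ℂ (pairQ a b) (ball (a : ℂ) ρ) := fun z _ =>
      (RhW07.Law421.SuccessorCertificate.hasDerivAt_quadP a b z :
        HasDerivAt (pairQ a b) (2 * (z - a)) z).differentiableAt.differentiableWithinAt
    exact ((differentiableOn_const _).mul (differentiableOn_id.sub (differentiableOn_const _))).add (hq.mul (hd.div hh hh0))
  have hΨre : ∀ x : ℝ, (Ψ x).re = 2 * (x - a) + (pairQ a b x * (deriv h x / h x)).re := by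
    intro x
    simp only [hΨ_def, Complex.add_re]
    have : (2 : ℂ) * ((x : ℂ) - a) = ((2 * (x - a) : ℝ) : ℂ) := by push_cast; ring
    rw [this, Complex.ofReal_re]
  have hΨc0 : Ψ c = 0 := by
    have h1 : deriv G c = 0 := by rw [← huc]; exact hGu
    rw [hGΨ _ hcball] at h1
    exact (mul_eq_zero.mp h1).resolve_left (hh0 _ hcball)
  -- `ψ := Re Ψ` on the reals
  set ψ : ℝ → ℝ := fun x => (Ψ x).re with hψ_def
  have hψcont : ContinuousOn ψ (Icc (a - r) (a + r)) := by
    have h2 : ContinuousOn (fun x : ℝ => Ψ (x : ℂ)) (Icc (a - r) (a + r)) := by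
      refine hΨd.continuousOn.comp Complex.continuous_ofReal.continuousOn ?_
      intro x hx
      exact hxball x (abs_le.mpr ⟨by linarith [hx.1], by linarith [hx.2]⟩)
    exact Complex.continuous_re.comp_continuousOn h2
  have hleft : ψ (a - r) < 0 := by
    have hz : ‖((a - r : ℝ) : ℂ) - (a : ℂ)‖ = r := by
      rw [← Complex.ofReal_sub, Complex.norm_real, Real.norm_eq_abs, show a - r - a = -r by ring, abs_neg, abs_of_pos hr]
    have hs := hsmall _ hz
    have hre := Complex.re_le_norm (pairQ a b ((a - r : ℝ) : ℂ) * (deriv h ((a - r : ℝ) : ℂ) / h ((a - r : ℝ) : ℂ)))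
    show (Ψ ((a - r : ℝ) : ℂ)).re < 0
    rw [hΨre]
    linarith
  have hright : 0 < ψ (a + r) := by
    have hz : ‖((a + r : ℝ) : ℂ) - (a : ℂ)‖ = r := by
      rw [← Complex.ofReal_sub, Complex.norm_real, Real.norm_eq_abs, show a + r - a = r by ring, abs_of_pos hr]
    have hs := hsmall _ hz
    have h1 := Complex.abs_re_le_norm (pairQ a b ((a + r : ℝ) : ℂ) * (deriv h ((a + r : ℝ) : ℂ) / h ((a + r : ℝ) : ℂ)))
    have h2 := neg_abs_le (pairQ a b ((a + r : ℝ) : ℂ) * (deriv h ((a + r : ℝ) : ℂ) / h ((a + r : ℝ) : ℂ))).re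
    show 0 < (Ψ ((a + r : ℝ) : ℂ)).re
    rw [hΨre]
    linarith
  -- zeros of `ψ` strictly inside are critical points of `G`, hence `= c`
  have hzero : ∀ x : ℝ, |x - a| < r → ψ x = 0 → x = c := by
    intro x hx hψx
    obtain ⟨hh_im, hh1_im, -⟩ := hreal x hx
    set H : ℝ := (h x).re with hH
    set H₁ : ℝ := (deriv h x).re with hH₁
    have hhx : h x = (H : ℂ) := by rw [hH]; exact Complex.ext (by simp) (by simp [hh_im])
    have hh1x : deriv h x = (H₁ : ℂ) := by rw [hH₁]; exact Complex.ext (by simp) (by simp [hh1_im])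
    have hΨx_eq : Ψ x = ((2 * (x - a) + ((x - a) ^ 2 + b ^ 2) * (H₁ / H) : ℝ) : ℂ) := by
      simp only [hΨ_def]
      rw [pairQ_ofReal, hhx, hh1x]
      push_cast
      ring
    have hre0 : (Ψ x).re = 0 := hψx
    have hΨx : Ψ x = 0 := by
      rw [hΨx_eq, Complex.ofReal_re] at hre0
      rw [hΨx_eq, hre0, Complex.ofReal_zero]
    have hGx : deriv G x = 0 := by rw [hGΨ _ (hxball x hx.le), hΨx, mul_zero]
    have hmem : (x : ℂ) ∈ closedBall (a : ℂ) r := by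
      rw [mem_closedBall, dist_eq_norm, ← Complex.ofReal_sub, Complex.norm_real, Real.norm_eq_abs]
      exact hx.le
    have := huniq _ hmem hGx
    rw [huc] at this
    exact_mod_cast this
  have hψc : ψ c = 0 := by
    show (Ψ c).re = 0
    rw [hΨc0, Complex.zero_re]
  -- the slope of `ψ` at `c` is `Re Ψ′(c) ≥ 0`
  have hΨc : HasDerivAt Ψ (deriv Ψ (c : ℂ)) (c : ℂ) := (hΨd.differentiableAt (isOpen_ball.mem_nhds hcball)).hasDerivAt
  have hψd : HasDerivAt ψ (deriv Ψ (c : ℂ)).re c := hΨc.real_of_complex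
  have hdnonneg : 0 ≤ (deriv Ψ (c : ℂ)).re := deriv_nonneg_of_unique_zero hψcont hleft hright hca hψc hzero hψd
  -- `G″(c) = h(c)·Ψ′(c)`
  have hG2 : deriv (deriv G) (c : ℂ) = h c * deriv Ψ c := by
    have hEq : deriv G =ᶠ[nhds (c : ℂ)] fun z => h z * Ψ z :=
      Filter.eventually_of_mem (isOpen_ball.mem_nhds hcball) fun z hz => hGΨ z hz
    rw [hEq.deriv_eq]
    have hhc : HasDerivAt h (deriv h c) c := (hh.differentiableAt (isOpen_ball.mem_nhds hcball)).hasDerivAt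
    have hprod : HasDerivAt (fun z => h z * Ψ z) (deriv h c * Ψ c + h c * deriv Ψ c) c := hhc.mul hΨc
    rw [hprod.deriv, hΨc0, mul_zero, zero_add]
  -- the values at `c`
  obtain ⟨hh_im, -, -⟩ := hreal c hca
  set H : ℝ := (h c).re with hH
  have hhc' : h c = (H : ℂ) := by rw [hH]; exact Complex.ext (by simp) (by simp [hh_im])
  have hHne : H ≠ 0 := by
    intro h0
    apply hh0 _ hcball
    rw [hhc', h0, Complex.ofReal_zero]
  have hQpos : 0 < (c - a) ^ 2 + b ^ 2 := by positivity
  have hGc : G c = ((((c - a) ^ 2 + b ^ 2) * H : ℝ) : ℂ) := by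
    rw [hG _ hcball, pairQ_ofReal, hhc']
    push_cast
    ring
  refine ⟨c, hca, by rw [← huc]; exact hGu, ?_, ?_⟩
  · rw [hGc, Complex.ofReal_re]
    exact mul_ne_zero hQpos.ne' hHne
  · rw [hGc, Complex.ofReal_re, hG2, hhc', Complex.re_ofReal_mul]
    have h0 : 0 ≤ ((c - a) ^ 2 + b ^ 2) * (H * H) * (deriv Ψ (c : ℂ)).re :=
      mul_nonneg (mul_nonneg hQpos.le (mul_self_nonneg H)) hdnonneg
    have e : ((c - a) ^ 2 + b ^ 2) * H * (H * (deriv Ψ (c : ℂ)).re) = ((c - a) ^ 2 + b ^ 2) * (H * H) * (deriv Ψ (c : ℂ)).re := by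
      ring
    rw [e]
    exact h0

open RhIdea6.G17.W07C7 RhIdea6.G17.W07C7.Rev6 RhIdea6.G18.W07C8.Law421BirthS RhIdea6.G19.W07C11.Seam RhIdea6.G20.W07C12.Frac in
/-- ★★ (K) §F.10b **ISOLATED PAIR AT LEVEL j ⇒ Ready′, CIRCLE TEST ONLY** (= `readyR2_of_isolated` WITHOUT `hsmall2`; realness of `h` from `hreal_of_conjSym`):
`f⁽ʲ⁾ = q·h` on `ball a ρ`, `h` zero-free, circle smallness at radius `r` (`0 < r < ρ`), `f⁽ʲ⁾` real, range `|a − x₀| + r ≤ (j+3)R/2` ⇒ `TiltReady ∧ ReadyR2` at level `j`. -/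
theorem readyR2_of_isolated_circle {f h : ℂ → ℂ} {j : ℕ} {a b r ρ x₀ : ℝ} (η s hmax R Hs : ℝ) (B : ℕ) (u : ℂ)
    (hr : 0 < r) (hrρ : r < ρ) (hb : 0 < b)
    (hh : DifferentiableOn ℂ h (ball (a : ℂ) ρ)) (hh0 : ∀ z ∈ ball (a : ℂ) ρ, h z ≠ 0)
    (hG : ∀ z ∈ ball (a : ℂ) ρ, iteratedDeriv j f z = pairQ a b z * h z)
    (hsmall : ∀ z : ℂ, ‖z - a‖ = r → ‖pairQ a b z * (deriv h z / h z)‖ < 2 * r)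
    (hGreal : ∀ z : ℂ, iteratedDeriv j f (conj z) = conj (iteratedDeriv j f z))
    (hwin : |a - x₀| + r ≤ ((j : ℝ) + 3) * R / 2) :
    RhW08.StSwap.TiltReady η f x₀ s hmax R Hs B j u ∧ RhW08.StSwap.ReadyR2 η f x₀ s hmax R Hs B j u := by
  obtain ⟨x, hxa, h1, h2, h3⟩ :=
    tilt_of_isolated_circle hr hrρ hb hh hh0 hG hsmall hGreal (hreal_of_conjSym hb.ne' hrρ.le hG hGreal)
  have hx : |x - x₀| < ((j : ℝ) + 3) * R / 2 := by
    have := abs_sub_le x a x₀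
    linarith
  have hT := tiltReady_of_nlShape η s hmax R Hs B u hx h1 h2 h3
  exact ⟨hT, readyR2_of_tiltReady hT⟩

/-- ★★★ (K) §F.10b **TRACKED ISOLATED PAIR ⇒ Ready′, G-ONLY FORM, CIRCLE TEST ONLY** (= `readyR2_of_tracked_pair` WITHOUT the convexity clause `hconv`): `f` real,
`G := f⁽ʲ⁾` holomorphic on `ball a ρ`, a SIMPLE zero `a + ib` (`0 < b < r < ρ`) with `a ± ib` the only zeros of `G` in the ball, the circle clause
`‖q·G′/G − 2(z − a)‖ < 2r` on `‖z − a‖ = r`, range `|a − x₀| + r ≤ (j+3)R/2` ⇒ `TiltReady ∧ ReadyR2` at level `j` (every `u`). -/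
theorem readyR2_of_tracked_pair_circle {f : ℂ → ℂ} {j : ℕ} {a b r ρ x₀ : ℝ} (η s hmax R Hs : ℝ) (B : ℕ) (u : ℂ)
    (hf : ∀ z : ℂ, f (conj z) = conj (f z))
    (hD : DifferentiableOn ℂ (iteratedDeriv j f) (ball (a : ℂ) ρ))
    (hb : 0 < b) (hbr : b < r) (hrρ : r < ρ)
    (hz : iteratedDeriv j f (a + b * I) = 0) (hz' : deriv (iteratedDeriv j f) (a + b * I) ≠ 0)
    (honly : ∀ z ∈ ball (a : ℂ) ρ, iteratedDeriv j f z = 0 → z = a + b * I ∨ z = a - b * I)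
    (hcirc : ∀ z : ℂ, ‖z - a‖ = r →
      ‖pairQ a b z * (deriv (iteratedDeriv j f) z / iteratedDeriv j f z) - 2 * (z - a)‖ < 2 * r)
    (hwin : |a - x₀| + r ≤ ((j : ℝ) + 3) * R / 2) :
    RhW08.StSwap.TiltReady η f x₀ s hmax R Hs B j u ∧ RhW08.StSwap.ReadyR2 η f x₀ s hmax R Hs B j u := by
  have hGreal := Literature.NumberTheory.LFunctions.iteratedDeriv_conj_of_conj hf j
  have hbρ : |b| < ρ := by rw [abs_of_pos hb]; linarith
  obtain ⟨h, hh, hh0, hG⟩ := exists_pair_factor_real hGreal hb.ne' hbρ hD hz hz' honly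
  have hr : 0 < r := hb.trans hbr
  have hq : ∀ z : ℂ, ‖z - a‖ = r → pairQ a b z ≠ 0 := fun z hz =>
    pairQ_ne_zero_of_circle (by rwa [abs_of_pos hb]) hz
  have hsmall := hsmall_of_logDeriv hrρ hh hh0 hG hq hcirc
  exact readyR2_of_isolated_circle η s hmax R Hs B u hr hrρ hb hh hh0 hG hsmall hGreal hwin

/-! ## §F.10c THE ALOFT LEMMA (contrapositive of the circle-test landing) -/

/-- (K) §F.10c DICTIONARY: off the pair, `2(z − a)/q(z) = 1/(z − (a + ib)) + 1/(z − (a − ib))` — the pair's own term of the hands' field sum `Σ m_u/(z − u)`. -/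
theorem two_mul_sub_div_pairQ {a b : ℝ} {z : ℂ} (h1 : z ≠ a + b * I) (h2 : z ≠ a - b * I) :
    2 * (z - a) / pairQ a b z = 1 / (z - (a + b * I)) + 1 / (z - (a - b * I)) := by
  have h1' : z - (a + b * I) ≠ 0 := sub_ne_zero.mpr h1
  have h2' : z - (a - b * I) ≠ 0 := sub_ne_zero.mpr h2
  rw [pairQ_eq_mul]
  field_simp
  ring

/-- (K) §F.10c CIRCLE CLAUSE FROM A COFACTOR-FIELD BOUND: `‖G′/G − 2(z − a)/q‖ ≤ L` on the circle `‖z − a‖ = r` (`|b| < r`) and `(r² + b²)·L < 2r`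
⇒ the circle clause `‖q·G′/G − 2(z − a)‖ < 2r` of `readyR2_of_tracked_pair(_circle)`. -/
theorem hcirc_of_cofactor_bound {G : ℂ → ℂ} {a b r L : ℝ} (hbr : |b| < r)
    (hL : ∀ z : ℂ, ‖z - a‖ = r → ‖deriv G z / G z - 2 * (z - a) / pairQ a b z‖ ≤ L)
    (hrL : (r ^ 2 + b ^ 2) * L < 2 * r) :
    ∀ z : ℂ, ‖z - a‖ = r → ‖pairQ a b z * (deriv G z / G z) - 2 * (z - a)‖ < 2 * r := by
  intro z hz
  have hq := pairQ_ne_zero_of_circle hbr hz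
  have key : pairQ a b z * (deriv G z / G z) - 2 * (z - a) = pairQ a b z * (deriv G z / G z - 2 * (z - a) / pairQ a b z) := by
    field_simp
  rw [key, norm_mul]
  have hLz := hL z hz
  have h0 : 0 ≤ L := (norm_nonneg _).trans hLz
  calc ‖pairQ a b z‖ * ‖deriv G z / G z - 2 * (z - a) / pairQ a b z‖ ≤ (r ^ 2 + b ^ 2) * L :=
        mul_le_mul (norm_pairQ_le_of_circle hz) hLz (norm_nonneg _) (by positivity)
    _ < 2 * r := hrL

/-- ★★★ (K) §F.10c **THE ALOFT LEMMA** (betaR g3's question «FarLevel + Charged ⇒ v.im ≥ s/η?», answered by the contrapositive of the circle-test landing):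
`f` real, `G := f⁽ʲ⁾` holomorphic on `ball a ρ`, a SIMPLE zero `a + ib` (`0 < b < ρ`) with `a ± ib` the only zeros of `G` in the ball, the COFACTOR FIELD bounded
on the punctured ball — `‖G′/G − 2(z − a)/q‖ ≤ L` wherever `G z ≠ 0` — the whole ball in range (`|a − x₀| + ρ ≤ (j+3)R/2`), and level `j` NOT Ready′ at some state
`u` ⇒ `1 ≤ b·L`. (If `b·L < 1`, the circle of radius `r ∈ (b, min ρ (1/L))` passes the test `(r² + b²)L < 2r` and the pair LANDS: Ready′.) With `L = η/s` this is
ALOFT `s/η ≤ b = lowH_j`, the hypothesis of part 4's `nested_step_energy_eta`. -/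
theorem aloft_of_not_readyR2 {f : ℂ → ℂ} {j : ℕ} {a b ρ x₀ L : ℝ} (η s hmax R Hs : ℝ) (B : ℕ) (u : ℂ)
    (hf : ∀ z : ℂ, f (conj z) = conj (f z))
    (hD : DifferentiableOn ℂ (iteratedDeriv j f) (ball (a : ℂ) ρ))
    (hb : 0 < b) (hbρ : b < ρ)
    (hz : iteratedDeriv j f (a + b * I) = 0) (hz' : deriv (iteratedDeriv j f) (a + b * I) ≠ 0)
    (honly : ∀ z ∈ ball (a : ℂ) ρ, iteratedDeriv j f z = 0 → z = a + b * I ∨ z = a - b * I)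
    (hL : ∀ z ∈ ball (a : ℂ) ρ, iteratedDeriv j f z ≠ 0 →
      ‖deriv (iteratedDeriv j f) z / iteratedDeriv j f z - 2 * (z - a) / pairQ a b z‖ ≤ L)
    (hwin : |a - x₀| + ρ ≤ ((j : ℝ) + 3) * R / 2)
    (hnot : ¬ RhW08.StSwap.ReadyR2 η f x₀ s hmax R Hs B j u) : 1 ≤ b * L := by
  by_contra hcon
  push Not at hcon
  -- a radius `r ∈ (b, ρ)` with `(r² + b²)·L < 2r`
  obtain ⟨r, hbr, hrρ, hrL⟩ : ∃ r : ℝ, b < r ∧ r < ρ ∧ (r ^ 2 + b ^ 2) * L < 2 * r := by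
    rcases le_or_gt L 0 with hL0 | hL0
    · refine ⟨(b + ρ) / 2, by linarith, by linarith, ?_⟩
      have h1 : (((b + ρ) / 2) ^ 2 + b ^ 2) * L ≤ 0 := mul_nonpos_of_nonneg_of_nonpos (by positivity) hL0
      have h2 : 0 < (b + ρ) / 2 := by linarith
      linarith
    · have hbL : b < 1 / L := by rw [lt_div_iff₀ hL0]; linarith
      set m : ℝ := min ρ (1 / L) with hm
      have hbm : b < m := lt_min hbρ hbL
      refine ⟨(b + m) / 2, by linarith, by linarith [min_le_left ρ (1 / L)], ?_⟩
      have hr1 : (b + m) / 2 < 1 / L := by linarith [min_le_right ρ (1 / L)]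
      have hr0 : 0 < (b + m) / 2 := by linarith
      have hrL' : (b + m) / 2 * L < 1 := by rwa [lt_div_iff₀ hL0] at hr1
      have hbL' : b * L < 1 := hcon
      -- r²L < r and b²L < b < r
      have e1 : ((b + m) / 2) ^ 2 * L < (b + m) / 2 := by
        have := mul_lt_mul_of_pos_left hrL' hr0
        nlinarith [this]
      have e2 : b ^ 2 * L < (b + m) / 2 := by
        have := mul_lt_mul_of_pos_left hbL' hb
        nlinarith [this]
      nlinarith [e1, e2]
  have hr : 0 < r := hb.trans hbr
  -- the circle clause at radius `r`
  have hcirc : ∀ z : ℂ, ‖z - a‖ = r →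
      ‖pairQ a b z * (deriv (iteratedDeriv j f) z / iteratedDeriv j f z) - 2 * (z - a)‖ < 2 * r := by
    refine hcirc_of_cofactor_bound (by rwa [abs_of_pos hb]) ?_ hrL
    intro z hzr
    have hzball : z ∈ ball (a : ℂ) ρ := by rw [mem_ball, dist_eq_norm]; linarith
    refine hL z hzball ?_
    intro hG0
    rcases honly z hzball hG0 with h | h
    · have : ‖z - (a : ℂ)‖ = b := by
        rw [h, show (a : ℂ) + b * I - a = b * I by ring, norm_mul, Complex.norm_I, mul_one, Complex.norm_real,
          Real.norm_eq_abs, abs_of_pos hb]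
      linarith
    · have : ‖z - (a : ℂ)‖ = b := by
        rw [h, show (a : ℂ) - b * I - a = -(b * I) by ring, norm_neg, norm_mul, Complex.norm_I, mul_one, Complex.norm_real,
          Real.norm_eq_abs, abs_of_pos hb]
      linarith
  have hwin' : |a - x₀| + r ≤ ((j : ℝ) + 3) * R / 2 := by linarith
  exact hnot (readyR2_of_tracked_pair_circle η s hmax R Hs B u hf hD hb hbr hrρ hz hz' honly hcirc hwin').2

/-- ★★ (K) §F.10c … in the far-law currency: cofactor field `≤ η/s` on the punctured ball and level `j` not Ready′ ⇒ `s/η ≤ b` (ALOFT). -/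
theorem aloft_eta_of_not_readyR2 {f : ℂ → ℂ} {j : ℕ} {a b ρ x₀ η s : ℝ} (hmax R Hs : ℝ) (B : ℕ) (u : ℂ)
    (hf : ∀ z : ℂ, f (conj z) = conj (f z))
    (hD : DifferentiableOn ℂ (iteratedDeriv j f) (ball (a : ℂ) ρ))
    (hb : 0 < b) (hbρ : b < ρ) (hη : 0 < η) (hs : 0 < s)
    (hz : iteratedDeriv j f (a + b * I) = 0) (hz' : deriv (iteratedDeriv j f) (a + b * I) ≠ 0)
    (honly : ∀ z ∈ ball (a : ℂ) ρ, iteratedDeriv j f z = 0 → z = a + b * I ∨ z = a - b * I)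
    (hL : ∀ z ∈ ball (a : ℂ) ρ, iteratedDeriv j f z ≠ 0 →
      ‖deriv (iteratedDeriv j f) z / iteratedDeriv j f z - 2 * (z - a) / pairQ a b z‖ ≤ η / s)
    (hwin : |a - x₀| + ρ ≤ ((j : ℝ) + 3) * R / 2)
    (hnot : ¬ RhW08.StSwap.ReadyR2 η f x₀ s hmax R Hs B j u) : s / η ≤ b := by
  have h1 := aloft_of_not_readyR2 η s hmax R Hs B u hf hD hb hbρ hz hz' honly hL hwin hnot
  rw [div_le_iff₀ hη]
  have : 1 * s ≤ b * (η / s) * s := mul_le_mul_of_nonneg_right h1 hs.le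
  have e : b * (η / s) * s = b * η := by field_simp
  linarith [this, e]

end RhW08.IsolatedTilt
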